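import Literature.Analysis.Pluripotential.FubiniStudyLeviMatrix
import Literature.Analysis.Pluripotential.RegularLocusLeviForm
import HarnessLib

/-!
# The total mass of the Fubini–Study Monge–Ampère measure on the affine chart of `ℙᴺ(ℂ)`

Topic `Literature/Analysis/Pluripotential`. Complement to `FubiniStudyLeviMatrix.lean` (Levi matrix
and determinant of `fsPotential w = ½ log(1 + Σ_p |w_p|²)`, `ω_FS = dd^c fsPotential`,
`dd^c = (i/π)∂∂̄`) and to `RegularLocusLeviForm.lean` (`heightDensity_self_eq`): the Monge–Ampère
density of the Fubini–Study potential and its TOTAL MASS,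

* `heightDensity_fsPotential` — **`(dd^c fsPotential)ᴺ = N!/(πᴺ(1+|w|²)^{N+1}) dλ`**;
* `integral_Ioi_mul_inv_pow` — `∫₀^∞ r (B+r²)^{-(j+2)} dr = 1/(2(j+1)B^{j+1})` (+ integrability);
* `lintegral_complex_inv_pow` — `∫_ℂ (B+|ζ|²)^{-(j+2)} dλ = π/((j+1)B^{j+1})` (polar coordinates);
* `lintegral_inv_pow_add_sum_norm_sq` — `∫_{ℂᴺ} (A + |w|²)^{-(N+j+1)} dλ = πᴺ j!/((N+j)! A^{j+1})`
  by induction on `N` (Fubini over `MeasurableEquiv.piFinSuccAbove`);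
* `lintegral_heightDensity_fsPotential` — **total mass `∫_{ℂᴺ} (dd^c fsPotential)ᴺ = 1`**
  (`= ∫_{ℙᴺ} ω_FSᴺ`; the hyperplane at infinity is Lebesgue-null).

These give the non-vacuity of the hypothesis of
`GuedjZeriahi2007_lelongNumber_eq_zero_of_regularMass_eq` (the current `c ω_FS` has full regular
mass `cᴺ`) and the mass `γᴺ` of the comparison bumps `γ · fsPotential((w - w₀)/η)` used in its
proof. Everything is PROVED; no definitions, no named facts.

## References

* Standard (e.g. J.-P. Demailly, Complex analytic and differential geometry, Ch. III, Example 1.14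
  for `(dd^c log(1+|z|²))ⁿ`); tagged folklore.
-/

noncomputable section

open scoped Topology ComplexConjugate ENNReal
open MeasureTheory Filter Set Metric Complex
open Literature.AlgebraicGeometry.HodgeTheory.BiextensionHeight (leviMatrix heightDensity
  fsPotential)

namespace Literature.Analysis.Pluripotential

variable {N : ℕ}

/-! ### The Monge–Ampère density of the Fubini–Study potential -/

/-- **The Monge–Ampère density of the Fubini–Study potential**:
`(dd^c ½log(1+|w|²))ᴺ = N!/(πᴺ (1+|w|²)^{N+1}) dλ`. [folklore] -/
theorem heightDensity_fsPotential (w : Fin N → ℂ) :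
    heightDensity N fsPotential w =
      (N.factorial : ℝ) / (Real.pi ^ N * (1 + ∑ r, ‖w r‖ ^ 2) ^ (N + 1)) := by
  have hSpos := one_add_sum_norm_sq_pos w
  rw [heightDensity_self_eq, det_leviMatrix_fsPotential, Complex.ofReal_re, div_pow]
  have hpi : Real.pi ≠ 0 := Real.pi_ne_zero
  have ht : (1 + ∑ r, ‖w r‖ ^ 2) ≠ 0 := hSpos.ne'
  field_simp

/-! ### The total mass `∫_{ℂᴺ} (dd^c ½log(1+|w|²))ᴺ = 1` -/

/-- The radial integral `∫₀^∞ r (B + r²)^{-(j+2)} dr = 1/(2(j+1)B^{j+1})` (`B > 0`), with the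
integrability of the integrand. [folklore] -/
theorem integral_Ioi_mul_inv_pow {B : ℝ} (hB : 0 < B) (j : ℕ) :
    (∫ r in Ioi (0 : ℝ), r * ((B + r ^ 2) ^ (j + 2))⁻¹ = (2 * (j + 1) * B ^ (j + 1))⁻¹) ∧
      IntegrableOn (fun r : ℝ ↦ r * ((B + r ^ 2) ^ (j + 2))⁻¹) (Ioi 0) := by
  set g : ℝ → ℝ := fun r ↦ -((2 * ((j : ℝ) + 1))⁻¹ * ((B + r ^ 2) ^ (j + 1))⁻¹) with hg
  have hpos : ∀ r : ℝ, 0 < B + r ^ 2 := fun r ↦ by positivity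
  have hderiv : ∀ r, HasDerivAt g (r * ((B + r ^ 2) ^ (j + 2))⁻¹) r := by
    intro r
    have h1 : HasDerivAt (fun r : ℝ ↦ B + r ^ 2) (2 * r) r := by
      simpa using ((hasDerivAt_id r).pow 2).const_add B
    have h2 : HasDerivAt (fun r : ℝ ↦ (B + r ^ 2) ^ (j + 1))
        (((j + 1 : ℕ) : ℝ) * (B + r ^ 2) ^ (j + 1 - 1) * (2 * r)) r := h1.pow (j + 1)
    rw [Nat.add_sub_cancel] at h2
    have h3 := (h2.inv (pow_ne_zero _ (hpos r).ne')).const_mul ((2 * ((j : ℝ) + 1))⁻¹) |>.neg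
    refine h3.congr_deriv ?_
    have hne : (B + r ^ 2) ≠ 0 := (hpos r).ne'
    push_cast
    field_simp
    ring
  have hgcont : Continuous g := by
    refine (continuous_const.mul ((continuous_const.add (continuous_id.pow 2)).pow _ |>.inv₀
      fun r ↦ pow_ne_zero _ (hpos r).ne')).neg
  have hlim : Tendsto g atTop (𝓝 0) := by
    have h1 : Tendsto (fun r : ℝ ↦ (B + r ^ 2) ^ (j + 1)) atTop atTop := by
      refine (tendsto_pow_atTop (Nat.succ_ne_zero j)).comp ?_
      exact tendsto_atTop_add_const_left _ _ (tendsto_pow_atTop two_ne_zero)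
    have h2 := (h1.inv_tendsto_atTop.const_mul ((2 * ((j : ℝ) + 1))⁻¹)).neg
    simpa [hg] using h2
  have hnonneg : ∀ r ∈ Ioi (0 : ℝ), 0 ≤ r * ((B + r ^ 2) ^ (j + 2))⁻¹ := fun r hr ↦ by
    have : 0 ≤ r := le_of_lt hr
    positivity
  refine ⟨?_, integrableOn_Ioi_deriv_of_nonneg hgcont.continuousWithinAt (fun r _ ↦ hderiv r)
    hnonneg hlim⟩
  rw [integral_Ioi_of_hasDerivAt_of_nonneg hgcont.continuousWithinAt (fun r _ ↦ hderiv r)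
    hnonneg hlim]
  simp only [hg]
  have hB' : B ^ (j + 1) ≠ 0 := pow_ne_zero _ hB.ne'
  field_simp
  ring

/-- **The planar integral** `∫_ℂ (B + |ζ|²)^{-(j+2)} dλ(ζ) = π/((j+1) B^{j+1})` (`B > 0`), via polar
coordinates. [folklore] -/
theorem lintegral_complex_inv_pow {B : ℝ} (hB : 0 < B) (j : ℕ) :
    ∫⁻ ζ : ℂ, ENNReal.ofReal (((B + ‖ζ‖ ^ 2) ^ (j + 2))⁻¹)
      = ENNReal.ofReal (Real.pi / ((j + 1) * B ^ (j + 1))) := by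
  rw [← Complex.lintegral_comp_polarCoord_symm, show polarCoord.target =
    Ioi (0 : ℝ) ×ˢ Ioo (-Real.pi) Real.pi from rfl]
  -- the integrand in polar coordinates
  set F : ℝ → ℝ≥0∞ := fun r ↦ ENNReal.ofReal (r * ((B + r ^ 2) ^ (j + 2))⁻¹) with hF
  set G : ℝ → ℝ≥0∞ := fun _ ↦ 1 with hG
  have hint : ∀ p ∈ Ioi (0 : ℝ) ×ˢ Ioo (-Real.pi) Real.pi,
      ENNReal.ofReal p.1 • ENNReal.ofReal (((B + ‖Complex.polarCoord.symm p‖ ^ 2) ^ (j + 2))⁻¹)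
        = F p.1 * G p.2 := by
    intro p hp
    rw [Complex.norm_polarCoord_symm, sq_abs, smul_eq_mul, hF, hG]
    beta_reduce
    rw [mul_one, ← ENNReal.ofReal_mul (le_of_lt hp.1)]
  rw [setLIntegral_congr_fun (measurableSet_Ioi.prod measurableSet_Ioo) hint,
    Measure.volume_eq_prod, ← Measure.prod_restrict,
    lintegral_prod_mul (f := F) (g := G) (by fun_prop) (by fun_prop), hG, lintegral_const,
    Measure.restrict_apply_univ, Real.volume_Ioo, one_mul, hF]
  obtain ⟨hval, hinteg⟩ := integral_Ioi_mul_inv_pow hB j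
  rw [← ofReal_integral_eq_lintegral_ofReal hinteg
    ((ae_restrict_iff' measurableSet_Ioi).2 (ae_of_all _ fun r hr ↦ by
      have : 0 ≤ r := le_of_lt hr
      positivity)), hval,
    ← ENNReal.ofReal_mul (by positivity)]
  congr 1
  have hB' : B ^ (j + 1) ≠ 0 := pow_ne_zero _ hB.ne'
  field_simp
  ring

/-- **The `ℂᴺ` integral** `∫ (A + |w|²)^{-(N+j+1)} dλ = πᴺ j!/(N+j)! · A^{-(j+1)}` (`A > 0`), by
induction on `N` (Fubini over the first coordinate and the planar integral). [folklore] -/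
theorem lintegral_inv_pow_add_sum_norm_sq (N j : ℕ) {A : ℝ} (hA : 0 < A) :
    ∫⁻ w : Fin N → ℂ, ENNReal.ofReal (((A + ∑ p, ‖w p‖ ^ 2) ^ (N + j + 1))⁻¹)
      = ENNReal.ofReal (Real.pi ^ N * j.factorial / (N + j).factorial * (A ^ (j + 1))⁻¹) := by
  induction N generalizing A with
  | zero =>
    simp only [Finset.univ_eq_empty, Finset.sum_empty, add_zero, zero_add, pow_zero, one_mul,
      lintegral_const]
    rw [volume_pi, Measure.pi_univ]
    simp only [Finset.univ_eq_empty, Finset.prod_empty, mul_one]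
    congr 1
    have : (j.factorial : ℝ) ≠ 0 := by positivity
    field_simp
  | succ N ih =>
    have hmp := (volume_preserving_piFinSuccAbove (fun _ : Fin (N + 1) ↦ ℂ) 0).symm
    rw [← hmp.lintegral_comp (by fun_prop)]
    have hsum : ∀ p : ℂ × (Fin N → ℂ),
        ∑ q, ‖(MeasurableEquiv.piFinSuccAbove (fun _ : Fin (N + 1) ↦ ℂ) 0).symm p q‖ ^ 2
          = ‖p.1‖ ^ 2 + ∑ q, ‖p.2 q‖ ^ 2 := by
      intro p
      rw [Fin.sum_univ_succ]
      simp [MeasurableEquiv.piFinSuccAbove]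
    simp_rw [hsum]
    rw [Measure.volume_eq_prod, lintegral_prod_symm _ (by fun_prop)]
    have hinner : ∀ w' : Fin N → ℂ,
        ∫⁻ ζ : ℂ, ENNReal.ofReal (((A + (‖ζ‖ ^ 2 + ∑ q, ‖w' q‖ ^ 2)) ^ (N + 1 + j + 1))⁻¹)
          = ENNReal.ofReal (Real.pi / ((N + j + 1 : ℕ) * (A + ∑ q, ‖w' q‖ ^ 2) ^ (N + j + 1)))
            := by
      intro w'
      have hB : 0 < A + ∑ q, ‖w' q‖ ^ 2 := by positivity
      have hfun : (fun ζ : ℂ ↦ ENNReal.ofReal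
          (((A + (‖ζ‖ ^ 2 + ∑ q, ‖w' q‖ ^ 2)) ^ (N + 1 + j + 1))⁻¹))
          = fun ζ ↦ ENNReal.ofReal ((((A + ∑ q, ‖w' q‖ ^ 2) + ‖ζ‖ ^ 2) ^ (N + j + 2))⁻¹) := by
        funext ζ
        rw [show N + 1 + j + 1 = N + j + 2 by ring, show A + (‖ζ‖ ^ 2 + ∑ q, ‖w' q‖ ^ 2)
          = (A + ∑ q, ‖w' q‖ ^ 2) + ‖ζ‖ ^ 2 by ring]
      rw [hfun, lintegral_complex_inv_pow hB (N + j)]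
      push_cast
      ring_nf
    simp_rw [hinner]
    have hsplit : ∀ w' : Fin N → ℂ,
        ENNReal.ofReal (Real.pi / ((N + j + 1 : ℕ) * (A + ∑ q, ‖w' q‖ ^ 2) ^ (N + j + 1)))
          = ENNReal.ofReal (Real.pi / (N + j + 1 : ℕ))
            * ENNReal.ofReal (((A + ∑ q, ‖w' q‖ ^ 2) ^ (N + j + 1))⁻¹) := by
      intro w'
      rw [← ENNReal.ofReal_mul (by positivity)]
      congr 1
      rw [div_mul_eq_div_mul_one_div, one_div]
    simp_rw [hsplit]
    rw [lintegral_const_mul _ (by fun_prop), ih hA, ← ENNReal.ofReal_mul (by positivity)]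
    congr 1
    rw [show N + 1 + j = (N + j) + 1 by ring, Nat.factorial_succ]
    push_cast
    have h1 : ((N + j).factorial : ℝ) ≠ 0 := by positivity
    have h2 : ((N : ℝ) + j + 1) ≠ 0 := by positivity
    have h3 : A ^ (j + 1) ≠ 0 := pow_ne_zero _ hA.ne'
    field_simp
    ring

/-- **Total mass of the Fubini–Study Monge–Ampère measure**: `∫_{ℂᴺ} (dd^c ½ log(1+|w|²))ᴺ = 1`
(`ω_FS` represents the hyperplane class and `∫_{ℙᴺ} ω_FSᴺ = 1`; the chart `{z₀ ≠ 0}` has full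
measure). [folklore] -/
theorem lintegral_heightDensity_fsPotential :
    ∫⁻ w : Fin N → ℂ, ENNReal.ofReal (heightDensity N fsPotential w) = 1 := by
  have h1 : ∀ w : Fin N → ℂ, ENNReal.ofReal (heightDensity N fsPotential w)
      = ENNReal.ofReal ((N.factorial : ℝ) / Real.pi ^ N)
        * ENNReal.ofReal (((1 + ∑ p, ‖w p‖ ^ 2) ^ (N + 0 + 1))⁻¹) := by
    intro w
    rw [heightDensity_fsPotential, ← ENNReal.ofReal_mul (by positivity)]
    congr 1
    rw [add_zero, div_mul_eq_div_mul_one_div, one_div]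
  simp_rw [h1]
  rw [lintegral_const_mul _ (by fun_prop), lintegral_inv_pow_add_sum_norm_sq N 0 one_pos,
    ← ENNReal.ofReal_mul (by positivity), ← ENNReal.ofReal_one]
  congr 1
  have : (N.factorial : ℝ) ≠ 0 := by positivity
  have : Real.pi ^ N ≠ 0 := by positivity
  simp only [Nat.factorial_zero, Nat.cast_one, mul_one, add_zero, one_pow, inv_one, zero_add]
  field_simp

end Literature.Analysis.Pluripotential

end
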